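/-
Origin: expansion seat `prover-pub-hodgecm-own-htheta-g2-0`, handover #H39 2026-08-21T14:05:49Z md5 27d5c452eccf (138 l.; NEW additive MODEL leaf — SCHAIN row 10 of 11: face-scope `_S`∕`_gal` twin of `HodgeCM/Model/Binders/Real34PinsROGT2.lean`-class head (scope triple ↦ `S c` ∕ `6 ≤ finrank ℚ c.K ∧ IsNormalClosure ℚ c.K L`); author item6-p2 (prover-pub-hodgecm2-item6-p2-0) under own-htheta; nothing cited beyond the record's binders; NOT an E term; sha256 f10d2aef78473a64fcc9b1e4ccad73abbf80baf6b3806c0ab0514479cb8e9003; CERT rc 0 + trio as in the header; NAMES for audit: HodgeCM.Model.Gen12PinsP2.real34_R2CET_S ) (`HOME/pub-hodgecm-own-htheta/stage81/HodgeCM/Model/Binders/Real34PinsROGT2S.lean`, md5 27d5c452eccf, 138 lines);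
landed by the p-seat packager p gen 32 (p-g32) in gate run 80 as `HodgeCM/Model/Binders/Real34PinsROGT2S.lean` (verbatim).
-/
/-
Copyright (c) 2026 the pub-hodgecm formalisation cell (harness21).  New file, not vendored.
Origin: seat `prover-pub-hodgecm2-item6-p2-0` (unit pub-hodgecm2-item6-p2, TRANSPOSITION item (vi) extra prover p2), 2026-08-21 — SCHAIN v2 (pub-hodgecm STATUS CLAIM
13:45:32Z): the `_S` form of D9, the one D head the `_ge` batches left out (x2 `D-HEADS-THREADING.md` row D9: it threads E's triple into A8's `hLiu` slot).
Target in PKG: `HodgeCM/Model/Binders/Real34PinsROGT2S.lean` (NEW additive leaf beside `Binders/Real34PinsROGT2.lean`, installed md5 dcc5509dd830; imports it + the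
installed D8 twin `Binders/Real34PinsROGT2Ge` (#H29, RUN 79) + `Model/E2InstanceOGR8S` (A8 `thetaSub_of_factOG_S`); nothing of record imports it).  KERNEL ONLY:
one theorem, no proof hole, nothing cited, no `def`; nothing here is a claim of the manuscripts under adjudication; HC_CM is NOT proved.

WHAT IT IS — `Gen12PinsP2.real34_R2CET_S (scope) (hscope) (h31) (hLiu) (CT)`: row 17 IN E's OWN TEXT at the R2 pins for an ARBITRARY scope class:
statement = `real34_R2CET` (:137) VERBATIM with the triple ↦ `scope c` (in `hLiu`'s type, in `CT`'s binder, in the conclusion's guard) and the regime proof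
inside `CT`'s type ↦ `isAnisotropic_of_goodCtx_ge V hc (hscope c hK)`; proof = the original's with `real34_R2C_of_GOG_T ↦ _ge`, `thetaSub_of_factOG ↦ _S`,
`hK.1 ↦ hscope c hK`.  Generated mechanically (edit list in the seat's `work/gen_schain.report`).
-/
import Summits.HodgeConjecture.HodgeCM.Model.Binders.Real34PinsROGT2Ge
import Summits.HodgeConjecture.HodgeCM.Model.E2InstanceOGR8S

/-! PORT of `HodgeCM/Model/Binders/Real34PinsROGT2S.lean` (HodgeCMPerL run 82) — verbatim mechanical port; provenance in the PORT header line. -/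

set_option autoImplicit false

noncomputable section

open MeasureTheory NumberField

namespace HodgeCM.Model

open HodgeCM HodgeCM.Universe HodgeCM.Adelic
open Literature.NumberTheory.Weil1964
open Literature.NumberTheory.Automorphic (piSchwartzBruhat archWeight)
open Literature.NumberTheory.GelbartRogawski1991.UnitaryDualPair
open Literature.AlgebraicGeometry.HodgeTheory
open Literature.NumberTheory.Automorphic.PicardCM
open Literature.NumberTheory.Transcendental (Arapura2012_Cor_15_4_6)
open HodgeCM.CMTypeOps (inflate)
open HodgeCM.Model.ThetaSpace
open HodgeCM.Model.ArchSideTerm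

namespace Gen12PinsP2

variable
  (hGR : ∀ {L : CMField} {ι₁ : L →+* ℂ} (V : HermSpace3 L ι₁) (c : SeesawCtx L),
    (cmSplittingDatum (L : Type) finProdFinEquiv (frameD V) (frameD_real V) (frameD_ne V) (dW c.D) (dW_real c.D)
      (dW_ne c.D)).CompatibleSplitting)
  (hGR₀ : ∀ {L : CMField} {ι₁ : L →+* ℂ} (V : HermSpace3 L ι₁) (c : SeesawCtx L),
    (cmSplittingDatum (L : Type) (e₁) (frameD V) (frameD_real V) (frameD_ne V) (lineVec (L : Type) (dW c.D 0))
      (fun _ => dW_real c.D 0) (fun _ => dW_ne c.D 0)).CompatibleSplitting)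
  (hGR₁ : ∀ {L : CMField} {ι₁ : L →+* ℂ} (V : HermSpace3 L ι₁) (c : SeesawCtx L),
    (cmSplittingDatum (L : Type) (e₁) (frameD V) (frameD_real V) (frameD_ne V) (lineVec (L : Type) (dW c.D 1))
      (fun _ => dW_real c.D 1) (fun _ => dW_ne c.D 1)).CompatibleSplitting)
  (hGR₂ : ∀ {L : CMField} {ι₁ : L →+* ℂ} (V : HermSpace3 L ι₁) (c : SeesawCtx L),
    (cmSplittingDatum (L : Type) (e₁) (frameD V) (frameD_real V) (frameD_ne V) (lineVec (L : Type) (dW' c.D 0))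
      (fun _ => dW'_real c.D 0) (fun _ => dW'_ne c.D 0)).CompatibleSplitting)
  (hGR₃ : ∀ {L : CMField} {ι₁ : L →+* ℂ} (V : HermSpace3 L ι₁) (c : SeesawCtx L),
    (cmSplittingDatum (L : Type) (e₁) (frameD V) (frameD_real V) (frameD_ne V) (lineVec (L : Type) (dW' c.D 1))
      (fun _ => dW'_real c.D 1) (fun _ => dW'_ne c.D 1)).CompatibleSplitting)
  (μ : ∀ {L : CMField}, SeesawCtx L → Fin 4 → NumberField.InfinitePlace (L : Type) → ℤ)
  (hΔ₁ : ∀ {L : CMField} {ι₁ : L →+* ℂ} (V : HermSpace3 L ι₁) (c : SeesawCtx L), ∀ hc : SInstance.GOG V c,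
    slotTypeVec V c (hGR V c) (hGR₀ V c) (hGR₁ V c) (hGR₂ V c) (hGR₃ V c) (SInstance.hG_GOG V c hc) 1 -
      slotTypeVec V c (hGR V c) (hGR₀ V c) (hGR₁ V c) (hGR₂ V c) (hGR₃ V c) (SInstance.hG_GOG V c hc) 0 = μ c 1 - μ c 0)
  (hΔ₂ : ∀ {L : CMField} {ι₁ : L →+* ℂ} (V : HermSpace3 L ι₁) (c : SeesawCtx L), ∀ hc : SInstance.GOG V c,
    slotTypeVec V c (hGR V c) (hGR₀ V c) (hGR₁ V c) (hGR₂ V c) (hGR₃ V c) (SInstance.hG_GOG V c hc) 2 -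
      slotTypeVec V c (hGR V c) (hGR₀ V c) (hGR₁ V c) (hGR₂ V c) (hGR₃ V c) (SInstance.hG_GOG V c hc) 0 = μ c 2 - μ c 0)
  (hΔ₃ : ∀ {L : CMField} {ι₁ : L →+* ℂ} (V : HermSpace3 L ι₁) (c : SeesawCtx L), ∀ hc : SInstance.GOG V c,
    slotTypeVec V c (hGR V c) (hGR₀ V c) (hGR₁ V c) (hGR₂ V c) (hGR₃ V c) (SInstance.hG_GOG V c hc) 3 -
      slotTypeVec V c (hGR V c) (hGR₀ V c) (hGR₁ V c) (hGR₂ V c) (hGR₃ V c) (SInstance.hG_GOG V c hc) 0 = μ c 3 - μ c 0)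

variable (hHD : exists_isReal_hodgeModel) (hI : hodgePQ_independent_of_hodgeModel)
  (h₁ : BallQuotientUniformised)  (h₃ : CMAbelianVarietyRealised)
  (h : Bool) (hA : Arapura2012_Cor_15_4_6)

/- the pins, spelled out: η_S := `@EtaChi.η (@SInstance.χVR @hGR @hGR₀ @hGR₁) (@SInstance.χWR @hGR @hGR₀ @hGR₁ @μ)` (likewise `hη_S`, `hηc_S`),
   W := `Gen12Pins.Wg @hGR η_S hη_S hηc_S @Gen12Pins.τSyl @Gen12Pins.TSyl @Gen12Pins.hTSyl` (= `HypCensus.Wcm hGR η_S hη_S hηc_S`, rfl),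
   S := `SInstance.SROGT'C @hGR @hGR₀ @hGR₁ @hGR₂ @hGR₃ @μ hΔ₁ hΔ₂ hΔ₃`
     (= `SInstance.SGPT' @SInstance.GOG @SInstance.hG_GOG @hGR η_S hη_S hηc_S @νR @hνR @hνcR @ν'R @hν'R @hν'cR @hGR₀..₃ @(SInstance.ART' … @SInstance.hpos_GOG hΔ₁ hΔ₂ hΔ₃)`, rfl). -/



/-- `_S` (SCOPE-PARAMETRIC) form of D9 `real34_R2CET`: E's scope triple ↦ a free class `scope c` (regime at `hscope`), the junction slot `hLiu` and the census slot `CT` typed at `scope`; proof = the original's over D8's twin `real34_R2C_of_GOG_T_ge` and A8's `thetaSub_of_factOG_S`. **Row 17 (`real34`) IN E's OWN TEXT at the (J-η) pins with the SATISFIABLE census binder** (twin of #39 `real34_ROGE`): from E's CM-inflation fact `h31`, ONE `hLiu` family in the oriented canonical text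
(C3 up to CM-inflation at every good sextic canonical context, all types and levels — glue-1 `thetaSub_of_factOG`) and ONE `Real34CensusSideT` per
good sextic canonical context (mc-binder-2's core ⊕ `hwedgeT`, typed at the regime `isAnisotropic_of_goodCtx` and the bit `orientBitι L ι₁`).  Proof:
`real34_R2C_of_GOG_T` on the guard read off the row's hypotheses. -/
theorem real34_R2CET_S (scope : ∀ {L : CMField}, SeesawCtx L → Prop) (hscope : ∀ {L : CMField} (c : SeesawCtx L), scope c → 6 ≤ Module.finrank ℚ c.K)
    (h31 : (picardCMUniverse hHD hI h₁ h₃).Fact_cmInflation)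
    (hLiu : ∀ {L : CMField} {ι₁ : L →+* ℂ} (V : HermSpace3 L ι₁) (c : SeesawCtx L),
      (thetaModelOf hHD hI h₁ h₃ (orientBitι L ι₁) (embOf hHD hI h₁ h₃) (coverOf hHD hI h₁ h₃ hA)
        (wmOfInput (HypCensus.Wcm hGR (@EtaChi.η (@SInstance.χVR @hGR @hGR₀ @hGR₁) (@SInstance.χWR @hGR @hGR₀ @hGR₁ @μ)) (@EtaChi.hη (@SInstance.χVR @hGR @hGR₀ @hGR₁) (@SInstance.χWR @hGR @hGR₀ @hGR₁ @μ))
          (@EtaChi.hηc (@SInstance.χVR @hGR @hGR₀ @hGR₁) (@SInstance.χWR @hGR @hGR₀ @hGR₁ @μ))))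
        (thetaOf _ (thetaClassInputOf _ (fun V c => thetaSpaceInputOf hHD hI h₁ h₃ (SInstance.SROGT'C @hGR @hGR₀ @hGR₁ @hGR₂ @hGR₃ @μ hΔ₁ hΔ₂ hΔ₃) V c)))
        (d12Of μ) (d34Of μ)).GoodCtx ι₁ c → scope c →
      (NumberField.InfinitePlace.mk ι₁).embedding = ι₁ →
      ∀ (i : Fin 4) (Γ : Level V), ∃ (M : CMField) (k : c.K →+* M) (σ' : M →+* ℂ), σ'.comp k = c.σ ∧
        (thetaModelOf hHD hI h₁ h₃ (orientBitι L ι₁) (embOf hHD hI h₁ h₃) (coverOf hHD hI h₁ h₃ hA)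
          (wmOfInput (HypCensus.Wcm hGR (@EtaChi.η (@SInstance.χVR @hGR @hGR₀ @hGR₁) (@SInstance.χWR @hGR @hGR₀ @hGR₁ @μ)) (@EtaChi.hη (@SInstance.χVR @hGR @hGR₀ @hGR₁) (@SInstance.χWR @hGR @hGR₀ @hGR₁ @μ))
            (@EtaChi.hηc (@SInstance.χVR @hGR @hGR₀ @hGR₁) (@SInstance.χWR @hGR @hGR₀ @hGR₁ @μ))))
          (thetaOf _ (thetaClassInputOf _ (fun V c => thetaSpaceInputOf hHD hI h₁ h₃ (SInstance.SROGT'C @hGR @hGR₀ @hGR₁ @hGR₂ @hGR₃ @μ hΔ₁ hΔ₂ hΔ₃) V c)))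
          (d12Of μ) (d34Of μ)).Theta V c i Γ ⊆
          (picardCMUniverse hHD hI h₁ h₃).Uiso Γ M (inflate k (c.Ψ i)) σ')
    (CT : ∀ {L : CMField} {ι₁ : L →+* ℂ} (V : HermSpace3 L ι₁) (c : SeesawCtx L)
      (hc : (thetaModelOf hHD hI h₁ h₃ (orientBitι L ι₁) (embOf hHD hI h₁ h₃) (coverOf hHD hI h₁ h₃ hA)
        (wmOfInput (HypCensus.Wcm hGR (@EtaChi.η (@SInstance.χVR @hGR @hGR₀ @hGR₁) (@SInstance.χWR @hGR @hGR₀ @hGR₁ @μ)) (@EtaChi.hη (@SInstance.χVR @hGR @hGR₀ @hGR₁) (@SInstance.χWR @hGR @hGR₀ @hGR₁ @μ))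
          (@EtaChi.hηc (@SInstance.χVR @hGR @hGR₀ @hGR₁) (@SInstance.χWR @hGR @hGR₀ @hGR₁ @μ))))
        (thetaOf _ (thetaClassInputOf _ (fun V c => thetaSpaceInputOf hHD hI h₁ h₃ (SInstance.SROGT'C @hGR @hGR₀ @hGR₁ @hGR₂ @hGR₃ @μ hΔ₁ hΔ₂ hΔ₃) V c)))
        (d12Of μ) (d34Of μ)).GoodCtx ι₁ c) (hK : scope c),
      (NumberField.InfinitePlace.mk ι₁).embedding = ι₁ →
      Real34CensusSideT @SInstance.GOG @SInstance.hG_GOG @hGR (@EtaChi.η (@SInstance.χVR @hGR @hGR₀ @hGR₁) (@SInstance.χWR @hGR @hGR₀ @hGR₁ @μ))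
        (@EtaChi.hη (@SInstance.χVR @hGR @hGR₀ @hGR₁) (@SInstance.χWR @hGR @hGR₀ @hGR₁ @μ)) (@EtaChi.hηc (@SInstance.χVR @hGR @hGR₀ @hGR₁) (@SInstance.χWR @hGR @hGR₀ @hGR₁ @μ)) (@SInstance.νR @hGR₁) (@SInstance.hνR @hGR₁) (@SInstance.hνcR @hGR₁) (@SInstance.ν'R @hGR₃) (@SInstance.hν'R @hGR₃) (@SInstance.hν'cR @hGR₃) @hGR₀ @hGR₁ @hGR₂ @hGR₃
        (@SInstance.ART' @SInstance.GOG @SInstance.hG_GOG @hGR (@SInstance.χVR @hGR @hGR₀ @hGR₁) (@SInstance.νR @hGR₁) (@SInstance.ν'R @hGR₃) @hGR₀ @hGR₁ @hGR₂ @hGR₃ @μ @SInstance.hpos_GOG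
          (fun V c hc => hΔ₁ V c hc) (fun V c hc => hΔ₂ V c hc) (fun V c hc => hΔ₃ V c hc))
        hHD hI h₁ h₃ (orientBitι L ι₁) hA @μ V c (isAnisotropic_of_goodCtx_ge V hc (hscope c hK))) :
    ∀ {L : CMField} {ι₁ : L →+* ℂ} (V : HermSpace3 L ι₁) (c : SeesawCtx L),
      (thetaModelOf hHD hI h₁ h₃ (orientBitι L ι₁) (embOf hHD hI h₁ h₃) (coverOf hHD hI h₁ h₃ hA)
        (wmOfInput (HypCensus.Wcm hGR (@EtaChi.η (@SInstance.χVR @hGR @hGR₀ @hGR₁) (@SInstance.χWR @hGR @hGR₀ @hGR₁ @μ)) (@EtaChi.hη (@SInstance.χVR @hGR @hGR₀ @hGR₁) (@SInstance.χWR @hGR @hGR₀ @hGR₁ @μ))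
          (@EtaChi.hηc (@SInstance.χVR @hGR @hGR₀ @hGR₁) (@SInstance.χWR @hGR @hGR₀ @hGR₁ @μ))))
        (thetaOf _ (thetaClassInputOf _ (fun V c => thetaSpaceInputOf hHD hI h₁ h₃ (SInstance.SROGT'C @hGR @hGR₀ @hGR₁ @hGR₂ @hGR₃ @μ hΔ₁ hΔ₂ hΔ₃) V c)))
        (d12Of μ) (d34Of μ)).GoodCtx ι₁ c → scope c →
      (NumberField.InfinitePlace.mk ι₁).embedding = ι₁ →
      Nonempty ((thetaModelOf hHD hI h₁ h₃ (orientBitι L ι₁) (embOf hHD hI h₁ h₃) (coverOf hHD hI h₁ h₃ hA)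
        (wmOfInput (HypCensus.Wcm hGR (@EtaChi.η (@SInstance.χVR @hGR @hGR₀ @hGR₁) (@SInstance.χWR @hGR @hGR₀ @hGR₁ @μ)) (@EtaChi.hη (@SInstance.χVR @hGR @hGR₀ @hGR₁) (@SInstance.χWR @hGR @hGR₀ @hGR₁ @μ))
          (@EtaChi.hηc (@SInstance.χVR @hGR @hGR₀ @hGR₁) (@SInstance.χWR @hGR @hGR₀ @hGR₁ @μ))))
        (thetaOf _ (thetaClassInputOf _ (fun V c => thetaSpaceInputOf hHD hI h₁ h₃ (SInstance.SROGT'C @hGR @hGR₀ @hGR₁ @hGR₂ @hGR₃ @μ hΔ₁ hΔ₂ hΔ₃) V c)))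
        (d12Of μ) (d34Of μ)).Real34FunBridge V c) :=
  fun {L} {ι₁} V c hc hK hcan =>
    real34_R2C_of_GOG_T_ge @hGR @hGR₀ @hGR₁ @hGR₂ @hGR₃ @μ hΔ₁ hΔ₂ hΔ₃ hHD hI h₁ h₃ (orientBitι L ι₁) hA V c
      ⟨hcan, (AdelicThetaCore.thetaModel_goodCtx_iff _ (orientBitι L ι₁) (d12Of μ) (d34Of μ) ι₁ c).mp hc⟩ hc (hscope c hK)
      (fun Γ => thetaSub_of_factOG_S hHD hI h₁ h₃ scope orientBitι hA
        (HypCensus.Wcm hGR (@EtaChi.η (@SInstance.χVR @hGR @hGR₀ @hGR₁) (@SInstance.χWR @hGR @hGR₀ @hGR₁ @μ)) (@EtaChi.hη (@SInstance.χVR @hGR @hGR₀ @hGR₁) (@SInstance.χWR @hGR @hGR₀ @hGR₁ @μ))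
          (@EtaChi.hηc (@SInstance.χVR @hGR @hGR₀ @hGR₁) (@SInstance.χWR @hGR @hGR₀ @hGR₁ @μ)))
        (fun V c => thetaSpaceInputOf hHD hI h₁ h₃ (SInstance.SROGT'C @hGR @hGR₀ @hGR₁ @hGR₂ @hGR₃ @μ hΔ₁ hΔ₂ hΔ₃) V c) μ h31 hLiu V c hc hK hcan 2 Γ)
      (fun Γ => thetaSub_of_factOG_S hHD hI h₁ h₃ scope orientBitι hA
        (HypCensus.Wcm hGR (@EtaChi.η (@SInstance.χVR @hGR @hGR₀ @hGR₁) (@SInstance.χWR @hGR @hGR₀ @hGR₁ @μ)) (@EtaChi.hη (@SInstance.χVR @hGR @hGR₀ @hGR₁) (@SInstance.χWR @hGR @hGR₀ @hGR₁ @μ))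
          (@EtaChi.hηc (@SInstance.χVR @hGR @hGR₀ @hGR₁) (@SInstance.χWR @hGR @hGR₀ @hGR₁ @μ)))
        (fun V c => thetaSpaceInputOf hHD hI h₁ h₃ (SInstance.SROGT'C @hGR @hGR₀ @hGR₁ @hGR₂ @hGR₃ @μ hΔ₁ hΔ₂ hΔ₃) V c) μ h31 hLiu V c hc hK hcan 3 Γ)
      (CT V c hc hK hcan)


end Gen12PinsP2

end HodgeCM.Model

end
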